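import Literature.RepresentationTheory.AdmissibleDirectSumMultiplicityOne
import Literature.RepresentationTheory.TwistedCoinvariantsCentralCharacterQuotient
import Mathlib.LinearAlgebra.TensorProduct.Basic
import HarnessLib

/-!
# Multiplicity at most one in a Matsushima-type decomposition
# `H ≅ ⨁_π (H¹(𝔤,K;π_∞)^{m(π)} ⊗ π_f)` with `m(π)·dim H¹ ≤ 1`

Topic `RepresentationTheory`; theorems only (no definition, no named fact).

Matsushima's formula (Borel–Wallach VII 3.2/3.4) decomposes the cohomology of a compact locally
symmetric space with coefficients, as a module over the finite-adelic Hecke side, as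
`H = ⨁_π m(π) · (H^•(𝔤, K_∞; π_∞) ⊗ π_f)`, the sum over the automorphic representations
`π = π_∞ ⊗ π_f` of the group, `m(π)` the automorphic multiplicity.  When every `π` contributes a
multiplicity space `M_π = H¹(𝔤,K_∞;π_∞)^{⊕ m(π)}` of dimension `m(π) · dim H¹(𝔤,K;π_∞) ≤ 1`
(Rogawski, *Automorphic representations of unitary groups in three variables*, Thm. 14.6.4:
`m(π) ∈ {0, 1}` on the `A`-packets of the inner forms of `U(3)`, and Prop. 15.2.1 (b):
`dim H¹(𝔤,K;π_∞) = 1` for the two cohomological non-tempered `π_∞`), and the finite parts `π_f`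
are irreducible, admissible and pairwise non-isomorphic, every irreducible representation `ω` of
the Hecke side occurs in `H` with multiplicity at most one: `rank Hom_G(ω, H) ≤ 1`.  (The index
of the direct sum below is the finite part `π_f`: several automorphic `π` with the same `π_f`
are GROUPED, their multiplicity space being `M_{π_f} = ⨁_{π_∞} H¹(𝔤,K;π_∞)^{⊕ m(π_∞ ⊗ π_f)}`,
which still has rank `≤ 1` when at most one cohomological `π_∞` matches and `m ≤ 1` — the
typer of the Matsushima isomorphism indexes by `π_f`.)  This file
proves that ABSTRACT statement (the algebra behind [Liu2021, Prop. 4.13]'s multiplicity-one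
sentence at `n = 3`, l. 2145), reducing it to the tree's direct-sum multiplicity lemma
`AdmissibleDirectSum.rank_intertwiningMap_le_one_of_equivariant_directSum` (Schur's lemma for
irreducible admissible representations, [Bump1997, Prop. 4.2.4]): a summand `M ⊗ W` with
`rank M ≤ 1` and `G` acting through the irreducible admissible `W` is either zero or equivariantly
isomorphic to `W`.

## Content (namespace `Literature.RepresentationTheory.MatsushimaMultiplicity`)

* `subsingleton_or_nonempty_equiv_of_rank_le_one` — for `rank_k M ≤ 1`, the representation
  `1_M ⊗ σ` on `M ⊗ W` is zero or equivalent to `σ`.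
* `rank_intertwiningMap_le_one_of_equivariant_directSum_tensor` — **the multiplicity lemma**:
  `H ≃ ⨁ p, (M p ⊗ W p)` equivariantly (trivial action on `M p`), `rank (M p) ≤ 1`, `σ p`
  irreducible admissible pairwise non-isomorphic, `G` with a compact open subgroup, `k`
  algebraically closed ⟹ `rank Hom_G(ρ, H) ≤ 1` for every irreducible `ρ`.
* `finrank_intertwiningMap_le_one_of_equivariant_directSum_tensor` — the `finrank` form.

## References
* [BorelWallach2000] A. Borel, N. Wallach, *Continuous cohomology, discrete subgroups, and
  representations of reductive groups*, 2nd ed., AMS 2000 — Ch. VII, Thm. 3.2 and Cor. 3.4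
  (Matsushima's formula).
* [Rogawski1990] J. Rogawski, *Automorphic representations of unitary groups in three variables*,
  Ann. of Math. Stud. 123 (1990) — Thm. 14.6.4 (p. 244), Prop. 15.2.1 (b) (p. 250).
* [Bump1997] D. Bump, *Automorphic Forms and Representations*, CUP 1997 — Prop. 4.2.4.
* [Liu2021] Y. Liu, Camb. J. Math. 9 (2021) — Prop. 4.13, proof l. 2145.
-/

noncomputable section

open scoped DirectSum TensorProduct

namespace Literature.RepresentationTheory

namespace MatsushimaMultiplicity

universe uk uG uV uH uP uM uW

variable {k : Type uk} [Field k] {G : Type uG} [Group G]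

/-! ### A summand `M ⊗ W` with `rank M ≤ 1` is zero or equivalent to `W` -/

section Summand

variable {M : Type uM} [AddCommGroup M] [Module k M] {W : Type uW} [AddCommGroup W] [Module k W]
  (σ : Representation k G W)

/-- The representation `1_M ⊗ σ` of `G` on `M ⊗ W` (trivial action on the multiplicity space `M`)
acts by `id_M ⊗ σ(g)`. [folklore] -/
private theorem tprod_trivial_apply (g : G) (x : M ⊗[k] W) :
    ((Representation.trivial k G M).tprod σ) g x = LinearMap.lTensor M (σ g) x := by
  rw [Representation.tprod_apply]
  rfl

/-- For a multiplicity space of rank `≤ 1` the summand `M ⊗ W` (with `G` acting through `σ` on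
`W`) is either zero or equivariantly isomorphic to `W` (`M = 0` or `M ≅ k` and
`k ⊗ W ≅ W`). [cite: BorelWallach2000, Ch. VII Cor. 3.4] -/
theorem subsingleton_or_nonempty_equiv_of_rank_le_one (hM : Module.rank k M ≤ 1) :
    Subsingleton (M ⊗[k] W) ∨
      Nonempty (((Representation.trivial k G M).tprod σ).Equiv σ) := by
  classical
  obtain ⟨v₀, hv₀⟩ := rank_le_one_iff.mp hM
  by_cases h0 : v₀ = 0
  · -- `M = 0`
    left
    have hM0 : ∀ m : M, m = 0 := fun m => by
      obtain ⟨r, rfl⟩ := hv₀ m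
      rw [h0, smul_zero]
    haveI : Subsingleton M := ⟨fun a b => by rw [hM0 a, hM0 b]⟩
    infer_instance
  · -- `M = k ∙ v₀ ≅ k`, and `k ⊗ W ≅ W`
    right
    have htop : (k ∙ v₀) = ⊤ := by
      refine Submodule.eq_top_iff'.mpr fun m => ?_
      obtain ⟨r, rfl⟩ := hv₀ m
      exact Submodule.smul_mem _ r (Submodule.mem_span_singleton_self v₀)
    let e₁ : k ≃ₗ[k] M :=
      (LinearEquiv.toSpanNonzeroSingleton k M v₀ h0).trans (LinearEquiv.ofTop _ htop)
    let e : M ⊗[k] W ≃ₗ[k] W :=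
      (TensorProduct.congr e₁.symm (LinearEquiv.refl k W)).trans (TensorProduct.lid k W)
    refine ⟨Representation.Equiv.mk e fun g => TensorProduct.ext' fun m w => ?_⟩
    simp only [LinearMap.coe_comp, LinearEquiv.coe_coe, Function.comp_apply]
    rw [tprod_trivial_apply]
    simp only [e, LinearMap.lTensor_tmul, LinearEquiv.trans_apply, TensorProduct.congr_tmul,
      LinearEquiv.refl_apply, TensorProduct.lid_tmul, map_smul]

variable [TopologicalSpace G]

/-- The zero representation is admissible. [folklore] -/
private theorem isAdmissible_of_subsingleton {V : Type uV} [AddCommGroup V] [Module k V]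
    [Subsingleton V] (ρ : Representation k G V) : ρ.IsAdmissible := by
  refine ⟨fun v => ?_, fun K _ => inferInstance⟩
  have : ρ.stabilizerSubgroup v = ⊤ := by
    ext g
    simp only [Representation.mem_stabilizerSubgroup, Subgroup.mem_top, iff_true]
    exact Subsingleton.elim _ _
  show IsOpen (ρ.stabilizerSubgroup v : Set G)
  rw [this]
  exact isOpen_univ

/-- `1_M ⊗ σ` is admissible when `σ` is and `rank M ≤ 1`. [cite: BernsteinZelevinsky1976, Definition 2.1(b)] -/
theorem isAdmissible_tprod_trivial_of_rank_le_one (hM : Module.rank k M ≤ 1)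
    (hσ : σ.IsAdmissible) : ((Representation.trivial k G M).tprod σ).IsAdmissible := by
  rcases subsingleton_or_nonempty_equiv_of_rank_le_one σ hM with hsub | hne
  · exact isAdmissible_of_subsingleton _
  · obtain ⟨e⟩ := hne
    exact Representation.IsAdmissible.of_equivariant _ e.symm.toLinearEquiv
      (fun g w => Representation.IntertwiningMap.isIntertwining
        (f := e.symm.toIntertwiningMap) (g := g) (v := w)) hσ

end Summand

/-! ### Irreducibility along an equivalence (plumbing) -/

/-- Irreducibility is invariant under equivalence of representations (via the associated
`k[G]`-modules). [folklore] -/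
private theorem isIrreducible_of_equiv {V : Type uV} [AddCommGroup V] [Module k V]
    {W : Type uW} [AddCommGroup W] [Module k W] {ρ : Representation k G V}
    {σ : Representation k G W} (e : ρ.Equiv σ) [ρ.IsIrreducible] : σ.IsIrreducible := by
  rw [Representation.irreducible_iff_isSimpleModule_asModule] at *
  exact IsSimpleModule.congr
    (LinearEquiv.ofBijective
      (Representation.IntertwiningMap.equivLinearMapAsModule ρ σ e.toIntertwiningMap)
      e.toLinearEquiv.bijective).symm

/-! ### The multiplicity lemma -/

section Multiplicity

variable [TopologicalSpace G] [SeparatelyContinuousMul G] [IsAlgClosed k]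
variable {V : Type uV} [AddCommGroup V] [Module k V] {ρ : Representation k G V}
variable {H : Type uH} [AddCommGroup H] [Module k H] {τ : Representation k G H}
variable {P : Type uP} {M : P → Type uM} [∀ p, AddCommGroup (M p)] [∀ p, Module k (M p)]
variable {W : P → Type uW} [∀ p, AddCommGroup (W p)] [∀ p, Module k (W p)]
variable {σ : ∀ p, Representation k G (W p)}

/-- **Multiplicity at most one in a Matsushima-type decomposition.**  Let `G` be a topological
group possessing a compact open subgroup and `k` an algebraically closed field.  Let the
representation `τ` of `G` on `H` be `G`-equivariantly isomorphic to `⨁ p, (M p ⊗ W p)`, `G`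
acting trivially on the multiplicity spaces `M p` and through `σ p` on `W p`, where every `M p`
has rank `≤ 1` ("`m(π) · dim H¹(𝔤,K;π_∞) ≤ 1`") and the `σ p` ("`π_f`") are irreducible,
admissible and pairwise non-isomorphic.  Then for every irreducible representation `ρ` of `G`
the space of intertwining maps `Hom_G(ρ, τ)` has `k`-rank `≤ 1`.  (Matsushima's formula
[BorelWallach2000, VII 3.2/3.4] with Rogawski's `m(π) ≤ 1` [Rogawski1990, Thm. 14.6.4] and
`dim H¹ = 1` [Rogawski1990, Prop. 15.2.1 (b)] is of this shape; the conclusion is Schur's lemma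
for admissible representations [Bump1997, Prop. 4.2.4] summand by summand.)
[cite: BorelWallach2000, Ch. VII Thm. 3.2 and Cor. 3.4] [cite: Bump1997, Proposition 4.2.4] -/
theorem rank_intertwiningMap_le_one_of_equivariant_directSum_tensor [ρ.IsIrreducible]
    (Φ : H ≃ₗ[k] ⨁ p, (M p ⊗[k] W p))
    (hΦ : ∀ (g : G) (x : H) (p : P), Φ (τ g x) p = LinearMap.lTensor (M p) (σ p g) (Φ x p))
    (hirr : ∀ p, (σ p).IsIrreducible) (hadm : ∀ p, (σ p).IsAdmissible)
    (hsep : ∀ p q, Nonempty ((σ p).Equiv (σ q)) → p = q)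
    (hM : ∀ p, Module.rank k (M p) ≤ 1)
    (hK : ∃ K : Subgroup G, IsOpen (K : Set G) ∧ IsCompact (K : Set G)) :
    Module.rank k (ρ.IntertwiningMap τ) ≤ 1 := by
  -- the summand representations `1_{M p} ⊗ σ p`
  let σ' : ∀ p, Representation k G (M p ⊗[k] W p) :=
    fun p => (Representation.trivial k G (M p)).tprod (σ p)
  have hΦ' : ∀ (g : G) (x : H) (p : P), Φ (τ g x) p = σ' p g (Φ x p) := fun g x p => by
    rw [hΦ, tprod_trivial_apply]
  have haux := fun p => subsingleton_or_nonempty_equiv_of_rank_le_one (G := G) (σ p) (hM p)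
  refine AdmissibleDirectSum.rank_intertwiningMap_le_one_of_equivariant_directSum (σ := σ') Φ hΦ'
    (fun p hnt => ?_) (fun p => isAdmissible_tprod_trivial_of_rank_le_one (σ p) (hM p) (hadm p))
    (fun p q hnt hpq => ?_) hK
  · -- irreducible or zero
    rcases haux p with hsub | hne
    · exact (not_subsingleton_iff_nontrivial.mpr hnt hsub).elim
    · obtain ⟨e⟩ := hne
      haveI := hirr p
      exact isIrreducible_of_equiv e.symm
  · -- pairwise non-isomorphic
    obtain ⟨e'⟩ := hpq
    rcases haux p with hsub | hnep
    · exact (not_subsingleton_iff_nontrivial.mpr hnt hsub).elim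
    obtain ⟨ep⟩ := hnep
    rcases haux q with hsubq | hneq
    · haveI := hsubq
      exact (not_subsingleton_iff_nontrivial.mpr hnt
        (e'.toLinearEquiv.toEquiv.subsingleton)).elim
    · obtain ⟨eq⟩ := hneq
      exact hsep p q ⟨ep.symm.trans (e'.trans eq)⟩

/-- The `finrank` form of `rank_intertwiningMap_le_one_of_equivariant_directSum_tensor`:
`dim_k Hom_G(ρ, τ) ≤ 1`. [cite: BorelWallach2000, Ch. VII Thm. 3.2 and Cor. 3.4]
[cite: Bump1997, Proposition 4.2.4] -/
theorem finrank_intertwiningMap_le_one_of_equivariant_directSum_tensor [ρ.IsIrreducible]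
    (Φ : H ≃ₗ[k] ⨁ p, (M p ⊗[k] W p))
    (hΦ : ∀ (g : G) (x : H) (p : P), Φ (τ g x) p = LinearMap.lTensor (M p) (σ p g) (Φ x p))
    (hirr : ∀ p, (σ p).IsIrreducible) (hadm : ∀ p, (σ p).IsAdmissible)
    (hsep : ∀ p q, Nonempty ((σ p).Equiv (σ q)) → p = q)
    (hM : ∀ p, Module.rank k (M p) ≤ 1)
    (hK : ∃ K : Subgroup G, IsOpen (K : Set G) ∧ IsCompact (K : Set G)) :
    Module.finrank k (ρ.IntertwiningMap τ) ≤ 1 := by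
  have h := rank_intertwiningMap_le_one_of_equivariant_directSum_tensor (ρ := ρ) (τ := τ) Φ hΦ hirr
    hadm hsep hM hK
  exact Module.finrank_le_of_rank_le (by exact_mod_cast h)

end Multiplicity

end MatsushimaMultiplicity

end Literature.RepresentationTheory

end
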